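import Mathlib.MeasureTheory.Measure.Haar.InnerProductSpace
import Mathlib.Analysis.InnerProductSpace.Projection.Reflection
import Mathlib.MeasureTheory.Group.MeasurableEquiv
import Literature.MeasureTheory.Hausdorff.UniformlyDistributed
import Literature.MeasureTheory.Hausdorff.SphereHausdorffFinite
import Literature.Analysis.FluidPDE.SphereIntegral
import HarnessLib

/-!
# The spherical Hausdorff measure is a constant multiple of the polar surface measure

Support file (all results proved) for Bartnik's existence theorem for the ADM energy
(`Literature.Geometry.Lorentzian.AFEnd.HasADMEnergy_of_isAsymptoticallyFlat`), whose flux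
integrals are taken with respect to the Euclidean Hausdorff measure `μHE[2]` on coordinate
spheres, while polar coordinates (and hence every divergence theorem available from Mathlib) are
phrased with `Measure.toSphere volume`.

Let `E` be a real inner product space of dimension `d + 1`, `S = {‖x‖ = 1}` its unit sphere.
Two measures live on `S`: the restriction `σ` of the (Euclidean-normalised) Hausdorff measure
`μHE[d]` of `E` (`(μHE[d]).comap Subtype.val`), and Mathlib's polar surface measure
`τ = volume.toSphere` (`τ A = (d+1) · vol {t ω | 0 < t < 1, ω ∈ A}`). Both are finite
(`SphereHausdorffFinite`) and invariant under the orthogonal group, which acts transitively on `S`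
(`reflection_sub`), so both are uniformly distributed on the metric space `S`; by Christensen's
lemma (`UniformlyDistributed`) they are proportional:

* `comap_euclideanHausdorff_eq_smul_toSphere` — `σ = κ • τ` with the explicit constant
  `κ = μHE[d] (S) / τ (S)` (in truth `κ = 1`, which would need an area formula and is not
  proved here; no statement below depends on the value of `κ`);
* `euclideanHausdorff_restrict_sphere_eq_map` — scaling: `μHE[d]` restricted to the sphere of
  radius `r > 0` is the image of `r^d • σ` under `ω ↦ r ω`;
* `setIntegral_sphere_euclideanHausdorff` — hence
  `∫_{‖x‖ = r} f dμHE[d] = κ r^d ∫ f(r ω) dτ(ω) = (κ r^d) • sphereIntegral volume f r`.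

## References

* P. Mattila, *Geometry of sets and measures in Euclidean spaces*, CUP 1995, Thm. 3.4 and §3
  (uniformly distributed measures; Haar measure on the sphere).
* H. Federer, *Geometric measure theory* (1969), 2.7.16 (invariant measures on homogeneous
  spaces), 3.2.13.
-/

noncomputable section

open Set Function Metric Module Submodule
open _root_.MeasureTheory _root_.MeasureTheory.Measure
open scoped ENNReal NNReal Topology RealInnerProductSpace Pointwise

namespace Literature.MeasureTheory.Hausdorff

variable {E : Type*} [NormedAddCommGroup E] [InnerProductSpace ℝ E] [FiniteDimensional ℝ E]
  [MeasurableSpace E] [BorelSpace E]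

/-! ### Transitivity of the orthogonal group on the unit sphere -/

omit [FiniteDimensional ℝ E] [MeasurableSpace E] [BorelSpace E] in
/-- The orthogonal group acts transitively on the unit sphere: the reflection in the hyperplane
orthogonal to `x - y` maps `x` to `y` (Mathlib's `reflection_sub`). [folklore] -/
theorem exists_linearIsometryEquiv_apply_eq (x y : sphere (0 : E) 1) :
    ∃ A : E ≃ₗᵢ[ℝ] E, A x = y :=
  ⟨reflection (ℝ ∙ ((x : E) - y))ᗮ,
    reflection_sub (by rw [norm_eq_of_mem_sphere x, norm_eq_of_mem_sphere y])⟩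

omit [FiniteDimensional ℝ E] [MeasurableSpace E] [BorelSpace E] in
/-- A linear isometry maps the trace of a ball on the unit sphere to the trace of the image
ball. [folklore] -/
theorem image_unitSphere_inter_ball (A : E ≃ₗᵢ[ℝ] E) (x : E) (r : ℝ) :
    A '' (sphere (0 : E) 1 ∩ ball x r) = sphere (0 : E) 1 ∩ ball (A x) r := by
  rw [Set.image_inter A.injective]
  have h1 : A '' sphere (0 : E) 1 = sphere (0 : E) 1 := by
    have := A.toIsometryEquiv.image_sphere 0 1
    rwa [LinearIsometryEquiv.coe_toIsometryEquiv, map_zero] at this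
  have h2 : A '' ball x r = ball (A x) r := by
    have := A.toIsometryEquiv.image_ball x r
    rwa [LinearIsometryEquiv.coe_toIsometryEquiv] at this
  rw [h1, h2]

omit [InnerProductSpace ℝ E] [FiniteDimensional ℝ E] [MeasurableSpace E] [BorelSpace E] in
/-- Balls of the unit sphere (for the induced metric) are traces of balls of `E`. [folklore] -/
theorem image_val_ball [NormedSpace ℝ E] (x : sphere (0 : E) 1) (r : ℝ) :
    (Subtype.val : sphere (0 : E) 1 → E) '' ball x r = sphere (0 : E) 1 ∩ ball (x : E) r := by
  have h : ball x r = (Subtype.val : sphere (0 : E) 1 → E) ⁻¹' ball (x : E) r := by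
    ext z
    rfl
  rw [h, Subtype.image_preimage_coe]

/-! ### Both measures are uniformly distributed on the sphere -/

omit [FiniteDimensional ℝ E] in
/-- **Rotation invariance of the spherical Hausdorff measure**: the `μHE[d]`-measure of the trace
of a ball on the unit sphere does not depend on the centre (isometries preserve Hausdorff
measures, and the orthogonal group is transitive on the sphere). [folklore] -/
theorem euclideanHausdorff_unitSphere_inter_ball_eq (d : ℕ) (x y : sphere (0 : E) 1) (r : ℝ) :
    (μHE[d] : Measure E) (sphere (0 : E) 1 ∩ ball (x : E) r) =
      (μHE[d] : Measure E) (sphere (0 : E) 1 ∩ ball (y : E) r) := by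
  obtain ⟨A, hA⟩ := exists_linearIsometryEquiv_apply_eq x y
  rw [← hA, ← image_unitSphere_inter_ball A, A.isometry.euclideanHausdorffMeasure_image]

/-- **Rotation invariance of the polar cones**: the volume of the cone
`{t ω | 0 < t < 1, ω ∈ S ∩ B(x, r)}` does not depend on the centre `x ∈ S` (linear isometries
preserve Lebesgue measure and commute with dilations). [folklore] -/
theorem volume_Ioo_smul_unitSphere_inter_ball_eq (x y : sphere (0 : E) 1) (r : ℝ) :
    volume (Ioo (0 : ℝ) 1 • (sphere (0 : E) 1 ∩ ball (x : E) r)) =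
      volume (Ioo (0 : ℝ) 1 • (sphere (0 : E) 1 ∩ ball (y : E) r)) := by
  obtain ⟨A, hA⟩ := exists_linearIsometryEquiv_apply_eq x y
  rw [← hA, ← image_unitSphere_inter_ball A]
  set W : Set E := sphere (0 : E) 1 ∩ ball (x : E) r with hW
  have hcomm : A '' (Ioo (0 : ℝ) 1 • W) = Ioo (0 : ℝ) 1 • (A '' W) := by
    simp only [← Set.image2_smul]
    exact Set.image_image2_distrib_right fun a b ↦ A.map_smul a b
  rw [← hcomm, ← LinearIsometryEquiv.coe_toMeasurableEquiv, MeasurableEquiv.image_eq_preimage_symm]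
  have hmp : MeasurePreserving A.toMeasurableEquiv.symm volume volume := A.symm.measurePreserving
  exact (hmp.measure_preimage_equiv _).symm

/-- The polar surface measure `volume.toSphere` is uniformly distributed on the unit sphere: the
measure of a ball does not depend on its centre. [folklore] -/
theorem toSphere_ball_eq (x y : sphere (0 : E) 1) (r : ℝ) :
    (volume : Measure E).toSphere (ball x r) = (volume : Measure E).toSphere (ball y r) := by
  rw [Measure.toSphere_apply' _ measurableSet_ball, Measure.toSphere_apply' _ measurableSet_ball,
    image_val_ball, image_val_ball, volume_Ioo_smul_unitSphere_inter_ball_eq x y r]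

omit [FiniteDimensional ℝ E] in
/-- The spherical Hausdorff measure `(μHE[d]).comap Subtype.val` is uniformly distributed on the
unit sphere: the measure of a ball does not depend on its centre. [folklore] -/
theorem comap_euclideanHausdorff_ball_eq (d : ℕ) (x y : sphere (0 : E) 1) (r : ℝ) :
    ((μHE[d] : Measure E).comap (Subtype.val : sphere (0 : E) 1 → E)) (ball x r) =
      ((μHE[d] : Measure E).comap (Subtype.val : sphere (0 : E) 1 → E)) (ball y r) := by
  have hme := MeasurableEmbedding.subtype_coe
    ((isClosed_sphere : IsClosed (sphere (0 : E) 1)).measurableSet)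
  rw [hme.comap_apply, hme.comap_apply, image_val_ball, image_val_ball]
  exact euclideanHausdorff_unitSphere_inter_ball_eq d x y r

omit [InnerProductSpace ℝ E] [FiniteDimensional ℝ E] in
/-- The total mass of `(μHE[d]).comap Subtype.val` is `μHE[d]` of the unit sphere. [folklore] -/
theorem comap_euclideanHausdorff_univ (d : ℕ) :
    ((μHE[d] : Measure E).comap (Subtype.val : sphere (0 : E) 1 → E)) univ =
      (μHE[d] : Measure E) (sphere (0 : E) 1) := by
  have hme := MeasurableEmbedding.subtype_coe
    ((isClosed_sphere : IsClosed (sphere (0 : E) 1)).measurableSet)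
  rw [hme.comap_apply, image_univ, Subtype.range_coe]

/-! ### Proportionality -/

/-- **The spherical Hausdorff measure is a constant multiple of the polar surface measure.** On
the unit sphere `S` of a `(d+1)`-dimensional real inner product space,
`(μHE[d]).comap Subtype.val = κ • volume.toSphere` with `κ = μHE[d] (S) / volume.toSphere S`
(`< ∞`). Both measures are finite and uniformly distributed (rotation invariant, the orthogonal
group being transitive), so Christensen's lemma (Mattila 1995, Thm. 3.4) applies. The true value
`κ = 1` is not asserted. [cite: Mattila1995, Thm. 3.4] -/
theorem comap_euclideanHausdorff_eq_smul_toSphere {d : ℕ} (hd : finrank ℝ E = d + 1) :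
    (μHE[d] : Measure E).comap (Subtype.val : sphere (0 : E) 1 → E) =
      ((μHE[d] : Measure E) (sphere (0 : E) 1) / (volume : Measure E).toSphere univ) •
        (volume : Measure E).toSphere := by
  set σ : Measure (sphere (0 : E) 1) := (μHE[d] : Measure E).comap Subtype.val with hσ
  set τ : Measure (sphere (0 : E) 1) := (volume : Measure E).toSphere with hτ
  have hnt : Nontrivial E := Module.nontrivial_of_finrank_pos (R := ℝ) (by omega)
  haveI : IsFiniteMeasure σ := ⟨by
    rw [hσ, comap_euclideanHausdorff_univ]
    exact euclideanHausdorffMeasure_sphere_lt_top hd 1⟩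
  obtain ⟨c, -, hc⟩ := exists_eq_smul_of_measure_ball_eq σ τ
    (comap_euclideanHausdorff_ball_eq d) toSphere_ball_eq (Measure.toSphere_ne_zero _)
  have hτ0 : τ univ ≠ 0 := by
    rw [Ne, measure_univ_eq_zero]
    exact Measure.toSphere_ne_zero _
  have hc' : c = σ univ / τ univ := by
    rw [hc, Measure.smul_apply, smul_eq_mul, mul_div_assoc,
      ENNReal.div_self hτ0 (measure_ne_top _ _), mul_one]
  rw [hc, hc', hσ, comap_euclideanHausdorff_univ]

/-! ### Spheres of arbitrary radius and integrals -/

omit [InnerProductSpace ℝ E] [FiniteDimensional ℝ E] in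
/-- **Scaling.** For `r > 0`, the restriction of `μHE[d]` to the sphere of radius `r` is the
image of `r^d • (μHE[d]).comap Subtype.val` (on the unit sphere) under `ω ↦ r ω`
(`μHE[d] (r • A) = r^d μHE[d] (A)`). [folklore] -/
theorem euclideanHausdorff_restrict_sphere_eq_map [NormedSpace ℝ E] (d : ℕ) {r : ℝ}
    (hr : 0 < r) :
    (μHE[d] : Measure E).restrict (sphere (0 : E) r) =
      ((‖r‖₊ ^ d : ℝ≥0) : ℝ≥0∞) • Measure.map (fun ω : sphere (0 : E) 1 ↦ r • (ω : E))
        ((μHE[d] : Measure E).comap (Subtype.val : sphere (0 : E) 1 → E)) := by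
  have hme := MeasurableEmbedding.subtype_coe
    ((isClosed_sphere : IsClosed (sphere (0 : E) 1)).measurableSet)
  have hg : Measurable fun ω : sphere (0 : E) 1 ↦ r • (ω : E) :=
    (continuous_const.smul continuous_subtype_val).measurable
  ext A hA
  rw [Measure.restrict_apply hA, Measure.smul_apply, Measure.map_apply hg hA, hme.comap_apply]
  have h1 : (Subtype.val : sphere (0 : E) 1 → E) '' ((fun ω : sphere (0 : E) 1 ↦ r • (ω : E)) ⁻¹' A)
      = sphere (0 : E) 1 ∩ (fun z : E ↦ r • z) ⁻¹' A :=
    Subtype.image_preimage_coe (sphere (0 : E) 1) ((fun z : E ↦ r • z) ⁻¹' A)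
  have h2 : A ∩ sphere (0 : E) r = r • (sphere (0 : E) 1 ∩ (fun z : E ↦ r • z) ⁻¹' A) := by
    ext z
    simp only [mem_inter_iff, Set.mem_smul_set, mem_preimage, mem_sphere_iff_norm, sub_zero]
    constructor
    · rintro ⟨hzA, hz⟩
      refine ⟨r⁻¹ • z, ⟨?_, by rwa [smul_inv_smul₀ hr.ne']⟩, smul_inv_smul₀ hr.ne' z⟩
      rw [norm_smul, norm_inv, Real.norm_eq_abs, abs_of_pos hr, hz, inv_mul_cancel₀ hr.ne']
    · rintro ⟨w, ⟨hw, hwA⟩, rfl⟩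
      exact ⟨hwA, by rw [norm_smul, Real.norm_eq_abs, abs_of_pos hr, hw, mul_one]⟩
  rw [h1, h2, Measure.euclideanHausdorffMeasure_smul₀ d hr.ne', ENNReal.smul_def, smul_eq_mul]

omit [InnerProductSpace ℝ E] [FiniteDimensional ℝ E] in
/-- The dilation `ω ↦ r ω` of the unit sphere (`r ≠ 0`) is a measurable embedding into `E`.
[folklore] -/
theorem measurableEmbedding_smul_val [NormedSpace ℝ E] {r : ℝ} (hr : r ≠ 0) :
    MeasurableEmbedding fun ω : sphere (0 : E) 1 ↦ r • (ω : E) :=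
  (MeasurableEquiv.smul₀ r hr).measurableEmbedding.comp
    (MeasurableEmbedding.subtype_coe
    ((isClosed_sphere : IsClosed (sphere (0 : E) 1)).measurableSet))

/-- **Sphere integrals against the Hausdorff measure in polar form.** On a `(d+1)`-dimensional
real inner product space, for `r > 0` and any `f`,
`∫_{‖x‖ = r} f dμHE[d] = (κ r^d) • ∫ f (r ω) dτ(ω) = (κ r^d) • sphereIntegral volume f r`, where
`τ = volume.toSphere` and `κ = μHE[d] (S) / τ (S)` is the (finite) proportionality constant of
`comap_euclideanHausdorff_eq_smul_toSphere`. This converts Hausdorff surface integrals into the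
polar-coordinate sphere integrals of `Literature.Analysis.FluidPDE.SphereIntegral`, for which
polar coordinates and differentiation in the radius are available. [folklore] -/
theorem setIntegral_sphere_euclideanHausdorff {F : Type*} [NormedAddCommGroup F] [NormedSpace ℝ F]
    {d : ℕ} (hd : finrank ℝ E = d + 1) {r : ℝ} (hr : 0 < r) (f : E → F) :
    ∫ x in sphere (0 : E) r, f x ∂(μHE[d] : Measure E) =
      ((((μHE[d] : Measure E) (sphere (0 : E) 1) / (volume : Measure E).toSphere univ).toReal *
        r ^ d) • Analysis.FluidPDE.sphereIntegral (volume : Measure E) f r) := by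
  rw [euclideanHausdorff_restrict_sphere_eq_map d hr, comap_euclideanHausdorff_eq_smul_toSphere hd,
    Measure.map_smul, smul_smul, integral_smul_measure, (measurableEmbedding_smul_val hr.ne').integral_map,
    Analysis.FluidPDE.sphereIntegral_def]
  congr 1
  rw [ENNReal.toReal_mul, ENNReal.coe_toReal, NNReal.coe_pow, coe_nnnorm, Real.norm_eq_abs,
    abs_of_pos hr, mul_comm]

/-- The proportionality constant `κ = μHE[d] (S) / volume.toSphere S` is finite. [folklore] -/
theorem euclideanHausdorff_div_toSphere_ne_top {d : ℕ} (hd : finrank ℝ E = d + 1) :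
    (μHE[d] : Measure E) (sphere (0 : E) 1) / (volume : Measure E).toSphere univ ≠ ∞ := by
  have hnt : Nontrivial E := Module.nontrivial_of_finrank_pos (R := ℝ) (by omega)
  have hτ0 : (volume : Measure E).toSphere univ ≠ 0 := by
    rw [Ne, measure_univ_eq_zero]
    exact Measure.toSphere_ne_zero _
  exact ENNReal.div_ne_top (euclideanHausdorffMeasure_sphere_lt_top hd 1).ne hτ0

end Literature.MeasureTheory.Hausdorff

end
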